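import Mathlib
import HarnessLib
import Summits.Langlands.Langlands.Theses.SkinnerWilesDefectOne
import Summits.Langlands.Langlands.Theorems.SkinnerWilesDefectOneSeedOfQuadraticBaseChangeDescentAux
import Summits.Langlands.Langlands.Theorems.SkinnerWilesDefectOneSeedOfQuadraticBaseChangeSixFacts

/-!
# Item `SeedOfQuadraticBaseChange` (stmt-Langlands-15158, route `SkinnerWilesDefectOne`):
# the descended regime IS the conjugation-invariant regime — the heart is the set of
# residual pairs whose ratio is moved by complex conjugation

Sequel of `…SeedOfQuadraticBaseChangeDescentAux` (the two implications
`ratio_conjInvariant_of_descends`, `descendsOdd_of_ratio_conjInvariant`).  For `F` imaginary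
quadratic, `O = 𝒪_{ℚ̄_p}` and `ρ₀` a residually upper-triangular integral model of a continuous `ρ`:

* `descendsOdd_iff_ratio_conjInvariant` — the residual ratio `χ̄_b/χ̄_a` extends to an ODD
  continuous unit-valued character of `Γ_ℚ` (the line lead's `DescendsOdd`, minus its `p ≠ 2`
  clause) iff it is invariant under the outer action of `Γ_ℚ` on `Γ_F`;
* `ratio_conjInvariant_of_one` — invariance under ONE element outside `res(Γ_F)` (e.g. any complex
  conjugation, `Rat.not_mem_range_absGaloisRestrict_of_isComplexConjugation`) suffices;
* `seedOfQuadraticBaseChange_of_nonInvariantSeed_sixFacts` /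
  `seedOfQuadraticBaseChange_of_conjMovedSeed_sixFacts` — hence the item holds, granted the six
  named facts of `…SixFacts` (`f₁ … f₄, e₁, e₂`), modulo the seed crux VERBATIM on residual pairs
  whose ratio is NOT `Gal(F/ℚ)`-invariant (`∃ τ σ σ', res σ' = τ res σ τ⁻¹ ∧ ψ̄(σ') ≠ ψ̄(σ)`), resp.
  is MOVED BY A COMPLEX CONJUGATION `c` (`∃ c σ σ', res σ' = c res σ c⁻¹ ∧ ψ̄(σ') ≠ ψ̄(σ)`): the heart
  of stmt-Langlands-12920 / 15158 in closed form (the "genuine" pairs of the lead's notes, now a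
  theorem of the tree rather than a gloss; `p = 3` included).  These hypotheses are OPEN STATEMENTS
  (the crux restricted to a population), not named facts; nothing here claims them.
-/

set_option linter.dupNamespace false -- project-wide option (lakefile weak.linter.dupNamespace); `Summit.Langlands.Langlands` is the mandated namespace

noncomputable section

namespace Summit.Langlands.Langlands.Theorems.SkinnerWilesDefectOne.SeedOfQuadraticBaseChange

open Summit.Langlands.Langlands.Theses.SkinnerWilesDefectOne
open Literature.NumberTheory.GaloisRepresentations Literature.NumberTheory.Automorphic
open NumberField IsLocalRing Filter Field Topology

/-! ### 3 (continued). The equivalence; one conjugation suffices -/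

section Descent

variable {F : Type} [Field F] [NumberField F] {p : ℕ} [Fact p.Prime]
  {O : ValuationSubring (PadicAlgCl p)}
  {ρ : FramedGaloisRep F (PadicAlgCl p) 2}
  {ρ₀ : absoluteGaloisGroup F →* Matrix.GeneralLinearGroup (Fin 2) O}

/-- **The descended regime is the conjugation-invariant regime** (`F` imaginary quadratic,
`O = 𝒪_{ℚ̄_p}`, `ρ₀` a residually upper-triangular integral model of a continuous `ρ`): the residual
ratio `χ̄_b/χ̄_a` extends to an ODD continuous unit-valued character of `Γ_ℚ` (the line lead's
`DescendsOdd`, minus its `p ≠ 2` clause) iff it is invariant under the outer action of `Γ_ℚ` on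
`Γ_F` — and then it also extends to an even one; parity is free because the two extensions differ
by the odd quadratic character of `F`.  So the GENUINE pairs of the seed's heart are exactly those
with `ψ̄^τ ≠ ψ̄` for some `τ`. [folklore] -/
theorem descendsOdd_iff_ratio_conjInvariant (hF : IsTotallyComplex F) (hdeg : Module.finrank ℚ F = 2)
    (hO : O = (Valued.v : Valuation (PadicAlgCl p) NNReal).valuationSubring)
    (hmod : ρ.HasUpperTriangularIntegralModel ρ₀) :
    (∃ η : absoluteGaloisGroup ℚ →ₜ* (PadicAlgCl p)ˣ,
      (∀ τ, Valued.v ((η τ : (PadicAlgCl p)ˣ) : PadicAlgCl p) = 1) ∧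
      (∀ σ : absoluteGaloisGroup F,
        Valued.v (((η (absGaloisRestrict ℚ F σ) : (PadicAlgCl p)ˣ) : PadicAlgCl p) *
            ((ρ₀ σ).val 0 0 : PadicAlgCl p) - ((ρ₀ σ).val 1 1 : PadicAlgCl p)) < 1) ∧
      (∀ c : absoluteGaloisGroup ℚ, IsComplexConjugation (Rat.castHom ℝ) c →
        Valued.v (((η c : (PadicAlgCl p)ˣ) : PadicAlgCl p) + 1) < 1)) ↔
    ∀ (τ : absoluteGaloisGroup ℚ) (σ σ' : absoluteGaloisGroup F),
      absGaloisRestrict ℚ F σ' = τ * absGaloisRestrict ℚ F σ * τ⁻¹ →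
      ((ρ₀ σ').val 1 1 * (ρ₀ σ).val 0 0 - (ρ₀ σ').val 0 0 * (ρ₀ σ).val 1 1 : O) ∈ maximalIdeal O :=
  ⟨fun ⟨η, _, hD, _⟩ τ σ σ' h => ratio_conjInvariant_of_descends hO η hD τ σ σ' h,
    descendsOdd_of_ratio_conjInvariant hF hdeg hO hmod⟩

/-- **One complex conjugation suffices.**  The residual ratio is invariant under the whole outer
action of `Γ_ℚ` as soon as it is invariant under `θ_c` for ONE element `c ∉ res(Γ_F)` (e.g. any
complex conjugation, `Rat.not_mem_range_absGaloisRestrict_of_isComplexConjugation`): on `res(Γ_F)`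
the action is inner and the ratio is a class function, and `Γ_ℚ = res(Γ_F) ⊔ res(Γ_F) c`.
[folklore] -/
theorem ratio_conjInvariant_of_one (hdeg : Module.finrank ℚ F = 2)
    (hmod : ρ.HasUpperTriangularIntegralModel ρ₀)
    {c : absoluteGaloisGroup ℚ}
    (hc : c ∉ ((absGaloisRestrict ℚ F).range : Subgroup (absoluteGaloisGroup ℚ)))
    (hinv : ∀ (σ σ' : absoluteGaloisGroup F),
      absGaloisRestrict ℚ F σ' = c * absGaloisRestrict ℚ F σ * c⁻¹ →
      ((ρ₀ σ').val 1 1 * (ρ₀ σ).val 0 0 - (ρ₀ σ').val 0 0 * (ρ₀ σ).val 1 1 : O) ∈ maximalIdeal O)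
    (τ : absoluteGaloisGroup ℚ) (σ σ' : absoluteGaloisGroup F)
    (h : absGaloisRestrict ℚ F σ' = τ * absGaloisRestrict ℚ F σ * τ⁻¹) :
    ((ρ₀ σ').val 1 1 * (ρ₀ σ).val 0 0 - (ρ₀ σ').val 0 0 * (ρ₀ σ).val 1 1 : O) ∈ maximalIdeal O := by
  classical
  haveI : Algebra.IsQuadraticExtension ℚ F := ⟨hdeg⟩
  haveI : IsGalois ℚ F := inferInstance
  -- the ratio as a character `ψ̄ : Γ_F → κˣ`, a class function
  set χa : absoluteGaloisGroup F →* (ResidueField O)ˣ := (hmod.2.residualChar 0).toHomUnits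
    with hχa_def
  set χb : absoluteGaloisGroup F →* (ResidueField O)ˣ := (hmod.2.residualChar 1).toHomUnits
    with hχb_def
  have hχa : ∀ g, ((χa g : (ResidueField O)ˣ) : ResidueField O) = residue O ((ρ₀ g).val 0 0) :=
    fun g => rfl
  have hχb : ∀ g, ((χb g : (ResidueField O)ˣ) : ResidueField O) = residue O ((ρ₀ g).val 1 1) :=
    fun g => rfl
  -- translation between the cross-multiplied congruence and `ψ̄ σ' = ψ̄ σ`
  have key : ∀ σ σ' : absoluteGaloisGroup F,
      ((ρ₀ σ').val 1 1 * (ρ₀ σ).val 0 0 - (ρ₀ σ').val 0 0 * (ρ₀ σ).val 1 1 : O) ∈ maximalIdeal O ↔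
        χb σ' * χa σ = χa σ' * χb σ := by
    intro σ σ'
    rw [← residue_eq_zero_iff, map_sub, map_mul, map_mul, sub_eq_zero, ← hχa, ← hχb, ← hχa, ← hχb,
      ← Units.val_mul, ← Units.val_mul, Units.val_injective.eq_iff]
  have hidx : ((absGaloisRestrict ℚ F).range : Subgroup (absoluteGaloisGroup ℚ)).index = 2 :=
    (SorensenPatching.index_range_absGaloisRestrict ℚ F).trans hdeg
  rw [key]
  by_cases hτ : τ ∈ ((absGaloisRestrict ℚ F).range : Subgroup (absoluteGaloisGroup ℚ))
  · -- inner case: `σ' = σ₀ σ σ₀⁻¹`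
    obtain ⟨σ₀, hσ₀⟩ := hτ
    have hσ₀' : absGaloisRestrict ℚ F σ₀ = τ := hσ₀
    have hσ' : σ' = σ₀ * σ * σ₀⁻¹ :=
      absGaloisRestrict_injective ℚ F (by rw [h, map_mul, map_mul, map_inv, hσ₀'])
    rw [hσ', map_mul, map_mul, map_inv, mul_inv_cancel_comm, map_mul, map_mul, map_inv,
      mul_inv_cancel_comm, mul_comm]
  · -- `τ = (τ c⁻¹) c` with `τ c⁻¹ = res σ₀`: `σ' = σ₀ (θ_c σ) σ₀⁻¹`
    have hτc : τ * c⁻¹ ∈ ((absGaloisRestrict ℚ F).range : Subgroup (absoluteGaloisGroup ℚ)) :=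
      (Subgroup.mul_mem_iff_of_index_two hidx).mpr (iff_of_false hτ (fun h => hc (by simpa using h)))
    obtain ⟨σ₀, hσ₀⟩ := hτc
    have hσ₀' : absGaloisRestrict ℚ F σ₀ = τ * c⁻¹ := hσ₀
    set σ₁ := absGaloisOuterConj ℚ F c σ with hσ₁_def
    have hσ₁ : absGaloisRestrict ℚ F σ₁ = c * absGaloisRestrict ℚ F σ * c⁻¹ :=
      absGaloisRestrict_absGaloisOuterConj ℚ F c σ
    have h₁ : χb σ₁ * χa σ = χa σ₁ * χb σ := (key σ σ₁).mp (hinv σ σ₁ hσ₁)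
    have hσ' : σ' = σ₀ * σ₁ * σ₀⁻¹ := absGaloisRestrict_injective ℚ F (by
      rw [h, map_mul, map_mul, map_inv, hσ₁, hσ₀']; group)
    rw [hσ', map_mul, map_mul, map_inv, mul_inv_cancel_comm, map_mul, map_mul, map_inv,
      mul_inv_cancel_comm, h₁]

end Descent

/-! ### 4. The item modulo the heart on NON-INVARIANT pairs -/

section Item

/-- **The item modulo the seed on conjugation-NON-invariant pairs, six named facts** (closing
composition of stmt-Langlands-15158, conditional; sharpens `seedOfQuadraticBaseChange_of_genuineSeed_sixFacts`,
p95941/…SixFacts).  Granted the six published named facts `f₁ … f₄, e₁, e₂` of the odd-descended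
chain and the seed crux `EisensteinProModularSeed` VERBATIM on residual pairs whose ratio
`χ̄_b/χ̄_a` is NOT invariant under the outer action of `Γ_ℚ` on `Γ_F` (`∃ τ σ σ'` with
`res σ' = τ res σ τ⁻¹` and `(ρ₀σ')₁₁(ρ₀σ)₀₀ ≢ (ρ₀σ')₀₀(ρ₀σ)₁₁`; an explicit hypothesis, NOT a named
fact: its truth is unknown), `SeedOfQuadraticBaseChange` holds: an invariant ratio is odd-descended
(`descendsOdd_of_ratio_conjInvariant`), which is the landed regime. -/
theorem seedOfQuadraticBaseChange_of_nonInvariantSeed_sixFacts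
    (f₁ : Literature.NumberTheory.EllipticCurves.BillereyMenares2016_thm22_exists_newform_odd)
    (f₂ : Literature.NumberTheory.EllipticCurves.Hida2000_thm326_exists_galoisRep)
    (f₃ : Literature.NumberTheory.EllipticCurves.Hida2000_thm326_ordinary_unitRoot)
    (f₄ : Literature.NumberTheory.EllipticCurves.Hida2000_thm326_inertia_of_level)
    (e₁ : Literature.NumberTheory.Automorphic.bianchi_cuspidal_regularLAlgebraic_eigenclassExists)
    (e₂ : Literature.NumberTheory.Automorphic.algebraicWeightEigenclass_continuousPoint)
    (hni : ∀ (F : Type) [Field F] [NumberField F], NumberField.IsTotallyComplex F → Module.finrank ℚ F = 2 →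
      ∀ (p : ℕ) [Fact p.Prime], p ≠ 2 → ∀ (O : ValuationSubring (PadicAlgCl p)),
      O = (Valued.v : Valuation (PadicAlgCl p) NNReal).valuationSubring →
      ∀ (ρ : Literature.NumberTheory.GaloisRepresentations.FramedGaloisRep F (PadicAlgCl p) 2)
        (ρ₀ : Field.absoluteGaloisGroup F →* Matrix.GeneralLinearGroup (Fin 2) O),
      ρ.toGaloisRep.IsIrreducible → (∀ᶠ v in Filter.cofinite, ρ.IsUnramifiedAt v) →
      ρ.HasUpperTriangularIntegralModel ρ₀ →
      (∃ k : ℕ, 2 ≤ k ∧ ∃ m : ℕ, 0 < m ∧ ∀ v : IsDedekindDomain.HeightOneSpectrum (NumberField.RingOfIntegers F), (p : NumberField.RingOfIntegers F) ∈ v.asIdeal →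
        Literature.NumberTheory.GaloisRepresentations.IsPDistinguishedAt ρ₀ v ∧ ∃ Q : Matrix.GeneralLinearGroup (Fin 2) (PadicAlgCl p),
          Valued.v (Q.val 0 0) ≤ Valued.v (Q.val 1 0) ∧
          ∀ σ, (Q⁻¹ * ρ.toLocal v σ * Q).val 1 0 = 0 ∧
            (σ ∈ Literature.NumberTheory.GaloisRepresentations.absInertia (v.adicCompletion F) →
              (Q⁻¹ * ρ.toLocal v σ * Q).val 1 1 ^ m = 1 ∧
              (Q⁻¹ * ρ.toLocal v σ * Q).val 0 0 ^ m =
                algebraMap (Padic p) (PadicAlgCl p)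
                  (((Literature.NumberTheory.GaloisRepresentations.GaloisRep.cyclotomicCharacter (v.adicCompletion F) p σ).val : PadicInt p) :
                    Padic p) ^ ((k - 1) * m))) →
      (∃ (τ : Field.absoluteGaloisGroup ℚ) (σ σ' : Field.absoluteGaloisGroup F),
        Literature.NumberTheory.GaloisRepresentations.absGaloisRestrict ℚ F σ' =
          τ * Literature.NumberTheory.GaloisRepresentations.absGaloisRestrict ℚ F σ * τ⁻¹ ∧
        ((ρ₀ σ').val 1 1 * (ρ₀ σ).val 0 0 - (ρ₀ σ').val 0 0 * (ρ₀ σ).val 1 1 : O) ∉ IsLocalRing.maximalIdeal O) →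
      ∃ (𝒰 : Literature.NumberTheory.Automorphic.BigHeckeGLn.TameLevel 2 F p) (r : Literature.NumberTheory.GaloisRepresentations.FramedGaloisRep F (PadicAlgCl p) 2)
        (r₀ : Field.absoluteGaloisGroup F →* Matrix.GeneralLinearGroup (Fin 2) O)
        (q : IsDedekindDomain.HeightOneSpectrum (NumberField.RingOfIntegers F)),
        r.toGaloisRep.IsIrreducible ∧ 𝒰.IsPadicallyAutomorphic r ∧
        r.HasUpperTriangularIntegralModel r₀ ∧
        (∀ g, ((r₀ g).val 0 0 - (ρ₀ g).val 0 0 : O) ∈ IsLocalRing.maximalIdeal O ∧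
          ((r₀ g).val 1 1 - (ρ₀ g).val 1 1 : O) ∈ IsLocalRing.maximalIdeal O) ∧
        (∃ k : ℕ, 2 ≤ k ∧ ∃ m : ℕ, 0 < m ∧ ∀ v : IsDedekindDomain.HeightOneSpectrum (NumberField.RingOfIntegers F), (p : NumberField.RingOfIntegers F) ∈ v.asIdeal →
          ∃ Q : Matrix.GeneralLinearGroup (Fin 2) (PadicAlgCl p),
            Valued.v (Q.val 0 0) ≤ Valued.v (Q.val 1 0) ∧
            ∀ σ, (Q⁻¹ * r.toLocal v σ * Q).val 1 0 = 0 ∧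
              (σ ∈ Literature.NumberTheory.GaloisRepresentations.absInertia (v.adicCompletion F) →
                (Q⁻¹ * r.toLocal v σ * Q).val 1 1 ^ m = 1 ∧
                (Q⁻¹ * r.toLocal v σ * Q).val 0 0 ^ m =
                  algebraMap (Padic p) (PadicAlgCl p)
                    (((Literature.NumberTheory.GaloisRepresentations.GaloisRep.cyclotomicCharacter (v.adicCompletion F) p σ).val : PadicInt p) :
                      Padic p) ^ ((k - 1) * m))) ∧
        (∀ v : IsDedekindDomain.HeightOneSpectrum (NumberField.RingOfIntegers F), v ≠ q → (p : NumberField.RingOfIntegers F) ∉ v.asIdeal →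
          (∀ 𝔓 ∈ v.primesAbove, ∀ σ ∈ 𝔓.inertia (Field.absoluteGaloisGroup F),
            ((ρ₀ σ).val 0 0 - 1 : O) ∈ IsLocalRing.maximalIdeal O ∧ ((ρ₀ σ).val 1 1 - 1 : O) ∈ IsLocalRing.maximalIdeal O) →
          v ∉ 𝒰.bad)) :
    SeedOfQuadraticBaseChange := by
  refine seedOfQuadraticBaseChange_of_genuineSeed_sixFacts f₁ f₂ f₃ f₄ e₁ e₂ ?_
  intro F _ _ hF hdeg p _ hp O hO ρ ρ₀ hirr hunr hmod hloc hnot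
  refine hni F hF hdeg p hp O hO ρ ρ₀ hirr hunr hmod hloc ?_
  by_contra hall
  push Not at hall
  exact hnot ((descendsOdd_iff_ratio_conjInvariant hF hdeg hO hmod).mpr hall)

/-- **The item modulo the seed on pairs moved by complex conjugation, six named facts** — the
same with the population cut down to ONE test: the seed crux VERBATIM on residual pairs for which
SOME complex conjugation `c ∈ Γ_ℚ` and `σ, σ' ∈ Γ_F` with `res σ' = c res σ c⁻¹` have
`(ρ₀σ')₁₁(ρ₀σ)₀₀ ≢ (ρ₀σ')₀₀(ρ₀σ)₁₁ (mod 𝔪)` (i.e. `ψ̄(c̃ σ c̃⁻¹) ≠ ψ̄(σ)`: the ratio is moved by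
`Gal(F/ℚ)`).  Reduction to the previous theorem by `ratio_conjInvariant_of_one` (one `c ∉ res(Γ_F)`
controls the whole outer action) and `exists_isComplexConjugation`. -/
theorem seedOfQuadraticBaseChange_of_conjMovedSeed_sixFacts
    (f₁ : Literature.NumberTheory.EllipticCurves.BillereyMenares2016_thm22_exists_newform_odd)
    (f₂ : Literature.NumberTheory.EllipticCurves.Hida2000_thm326_exists_galoisRep)
    (f₃ : Literature.NumberTheory.EllipticCurves.Hida2000_thm326_ordinary_unitRoot)
    (f₄ : Literature.NumberTheory.EllipticCurves.Hida2000_thm326_inertia_of_level)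
    (e₁ : Literature.NumberTheory.Automorphic.bianchi_cuspidal_regularLAlgebraic_eigenclassExists)
    (e₂ : Literature.NumberTheory.Automorphic.algebraicWeightEigenclass_continuousPoint)
    (hcm : ∀ (F : Type) [Field F] [NumberField F], NumberField.IsTotallyComplex F → Module.finrank ℚ F = 2 →
      ∀ (p : ℕ) [Fact p.Prime], p ≠ 2 → ∀ (O : ValuationSubring (PadicAlgCl p)),
      O = (Valued.v : Valuation (PadicAlgCl p) NNReal).valuationSubring →
      ∀ (ρ : Literature.NumberTheory.GaloisRepresentations.FramedGaloisRep F (PadicAlgCl p) 2)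
        (ρ₀ : Field.absoluteGaloisGroup F →* Matrix.GeneralLinearGroup (Fin 2) O),
      ρ.toGaloisRep.IsIrreducible → (∀ᶠ v in Filter.cofinite, ρ.IsUnramifiedAt v) →
      ρ.HasUpperTriangularIntegralModel ρ₀ →
      (∃ k : ℕ, 2 ≤ k ∧ ∃ m : ℕ, 0 < m ∧ ∀ v : IsDedekindDomain.HeightOneSpectrum (NumberField.RingOfIntegers F), (p : NumberField.RingOfIntegers F) ∈ v.asIdeal →
        Literature.NumberTheory.GaloisRepresentations.IsPDistinguishedAt ρ₀ v ∧ ∃ Q : Matrix.GeneralLinearGroup (Fin 2) (PadicAlgCl p),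
          Valued.v (Q.val 0 0) ≤ Valued.v (Q.val 1 0) ∧
          ∀ σ, (Q⁻¹ * ρ.toLocal v σ * Q).val 1 0 = 0 ∧
            (σ ∈ Literature.NumberTheory.GaloisRepresentations.absInertia (v.adicCompletion F) →
              (Q⁻¹ * ρ.toLocal v σ * Q).val 1 1 ^ m = 1 ∧
              (Q⁻¹ * ρ.toLocal v σ * Q).val 0 0 ^ m =
                algebraMap (Padic p) (PadicAlgCl p)
                  (((Literature.NumberTheory.GaloisRepresentations.GaloisRep.cyclotomicCharacter (v.adicCompletion F) p σ).val : PadicInt p) :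
                    Padic p) ^ ((k - 1) * m))) →
      (∃ (c : Field.absoluteGaloisGroup ℚ) (σ σ' : Field.absoluteGaloisGroup F),
        Literature.NumberTheory.GaloisRepresentations.IsComplexConjugation (Rat.castHom ℝ) c ∧
        Literature.NumberTheory.GaloisRepresentations.absGaloisRestrict ℚ F σ' =
          c * Literature.NumberTheory.GaloisRepresentations.absGaloisRestrict ℚ F σ * c⁻¹ ∧
        ((ρ₀ σ').val 1 1 * (ρ₀ σ).val 0 0 - (ρ₀ σ').val 0 0 * (ρ₀ σ).val 1 1 : O) ∉ IsLocalRing.maximalIdeal O) →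
      ∃ (𝒰 : Literature.NumberTheory.Automorphic.BigHeckeGLn.TameLevel 2 F p) (r : Literature.NumberTheory.GaloisRepresentations.FramedGaloisRep F (PadicAlgCl p) 2)
        (r₀ : Field.absoluteGaloisGroup F →* Matrix.GeneralLinearGroup (Fin 2) O)
        (q : IsDedekindDomain.HeightOneSpectrum (NumberField.RingOfIntegers F)),
        r.toGaloisRep.IsIrreducible ∧ 𝒰.IsPadicallyAutomorphic r ∧
        r.HasUpperTriangularIntegralModel r₀ ∧
        (∀ g, ((r₀ g).val 0 0 - (ρ₀ g).val 0 0 : O) ∈ IsLocalRing.maximalIdeal O ∧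
          ((r₀ g).val 1 1 - (ρ₀ g).val 1 1 : O) ∈ IsLocalRing.maximalIdeal O) ∧
        (∃ k : ℕ, 2 ≤ k ∧ ∃ m : ℕ, 0 < m ∧ ∀ v : IsDedekindDomain.HeightOneSpectrum (NumberField.RingOfIntegers F), (p : NumberField.RingOfIntegers F) ∈ v.asIdeal →
          ∃ Q : Matrix.GeneralLinearGroup (Fin 2) (PadicAlgCl p),
            Valued.v (Q.val 0 0) ≤ Valued.v (Q.val 1 0) ∧
            ∀ σ, (Q⁻¹ * r.toLocal v σ * Q).val 1 0 = 0 ∧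
              (σ ∈ Literature.NumberTheory.GaloisRepresentations.absInertia (v.adicCompletion F) →
                (Q⁻¹ * r.toLocal v σ * Q).val 1 1 ^ m = 1 ∧
                (Q⁻¹ * r.toLocal v σ * Q).val 0 0 ^ m =
                  algebraMap (Padic p) (PadicAlgCl p)
                    (((Literature.NumberTheory.GaloisRepresentations.GaloisRep.cyclotomicCharacter (v.adicCompletion F) p σ).val : PadicInt p) :
                      Padic p) ^ ((k - 1) * m))) ∧
        (∀ v : IsDedekindDomain.HeightOneSpectrum (NumberField.RingOfIntegers F), v ≠ q → (p : NumberField.RingOfIntegers F) ∉ v.asIdeal →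
          (∀ 𝔓 ∈ v.primesAbove, ∀ σ ∈ 𝔓.inertia (Field.absoluteGaloisGroup F),
            ((ρ₀ σ).val 0 0 - 1 : O) ∈ IsLocalRing.maximalIdeal O ∧ ((ρ₀ σ).val 1 1 - 1 : O) ∈ IsLocalRing.maximalIdeal O) →
          v ∉ 𝒰.bad)) :
    SeedOfQuadraticBaseChange := by
  refine seedOfQuadraticBaseChange_of_nonInvariantSeed_sixFacts f₁ f₂ f₃ f₄ e₁ e₂ ?_
  intro F _ _ hF hdeg p _ hp O hO ρ ρ₀ hirr hunr hmod hloc hni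
  refine hcm F hF hdeg p hp O hO ρ ρ₀ hirr hunr hmod hloc ?_
  by_contra hall
  push Not at hall
  obtain ⟨τ, σ, σ', hσ', hne⟩ := hni
  obtain ⟨c, hc⟩ := exists_isComplexConjugation (Rat.castHom ℝ)
  exact hne (ratio_conjInvariant_of_one hdeg hmod
    (Rat.not_mem_range_absGaloisRestrict_of_isComplexConjugation F hF hc)
    (fun σ₁ σ₁' h => hall c σ₁ σ₁' hc h) τ σ σ' hσ')

end Item

end Summit.Langlands.Langlands.Theorems.SkinnerWilesDefectOne.SeedOfQuadraticBaseChange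

end
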